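import Summits.QuantumFields.YangMills.Theorems.UnitScaleGibbsBlockPlaquetteOneStepFullLinearisation
import Summits.QuantumFields.YangMills.Theorems.BalabanUVNodesN21LocalAveragedRegularity
import HarnessLib

/-!
# `BlockPlaquetteLinearisationLocal` — THE ONE-STEP BLOCK PLAQUETTE LINEARISATION UNDER WALK-LOCAL HYPOTHESES
# ((M1) ✓`BlockPlaquetteOneStepLinearisation` and px10's (K)∕(S) ✓`UnitScaleGibbsBlockPlaquetteOneStepFullLinearisation`, LOCAL EDITION — the box
# form the S_lin ∕ `stub_linTest` stub of LINE 28 «gross-sd-transfer» reads on construction C3's box; crux `UnitScaleTilt.HistoryTailL`, stmt-QuantumFields-19936)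

Cell `ym3-torus` (YM ladder rung R3 = continuum SU(2) Yang–Mills on T³ — a RUNG, NOT the Clay problem: not d = 4, not infinite volume, not a
mass gap), width seat `ym-ust-19936-w2` (gen 14).  LINE 28 skeleton v1 (ideator `ym-r3-idea-2` g16) `stub_linTest` reads the `j`-fold block plaquette of
the axial-gauge representative of a NON-WRAPPING BOX of side `n ≤ C·L^{j}` on the level-0 small-field event of that box: every hypothesis the
deterministic linearisation consumes must therefore be LOCAL.  The tree's (M1) ✓`norm_plaqHol_avgFun_sub_one_sub_offsetMean_le` and px10's (K)∕(S)
✓`norm_plaqHol_avgFun_sub_one_sub_fullLin(_proxy)_le` carry the GLOBAL hypothesis `∀ q, dist₁(U(∂q)) ≤ a`; but (M1) was landed ATOMISED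
(`…_of_atoms`: only the sizes of the four families of loop variables, the transport loops and the translated squares at `p′` enter), and the cell
`pub-ymgap`'s ✓`N21LocalAveragedRegularity` §1 bounds exactly these atoms under the WALK-LOCAL hypothesis of ✓`HistoryTailStokesLocal`:
  «every fine plaquette cornered at `walkEnd (emb p′₋) v`, `|v| ≤ (d+4)L + 2`, is within `a` of `1`»
(the walk hull of radius `(d+4)L + 2` fine steps around the block centre; box form by ✓`HistoryTailWalkLocality.walkLocal_of_box`).

WHAT THIS FILE PROVES (kernel; 0 `def`, 0 `sorry`; every cited engine BY NAME, nothing re-proved):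
* §1 ★ `norm_plaqHol_avgFun_sub_one_sub_offsetMean_le_loc` — (M1) under the walk-local hypothesis, SAME constant `143·s²`;
* §2 ★★ `norm_plaqHol_avgFun_sub_one_sub_fullLin_le_loc` — px10's (K) (one averaging step linearised down to the fine plaquette variables,
  `143·s² + (L²a)²`) under the walk-local hypothesis (the `L²` plaquettes of every translated square are walk sites of the same hull);
* §3 ★★ `norm_plaqHol_avgFun_sub_one_sub_fullLin_proxy_le_loc` — px10's (S) (the substitution step, `+ L²·ρ`) with the remainder bound
  `‖R q‖ ≤ ρ` asked ONLY at the plaquettes cornered in the same hull (the proxy identity `U(∂q) − 1 = A q + R q` may stay global: it is the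
  consumer's definition of `R`).
The `j`-fold transport-free induction on a cone of hulls is the companion `UnitScaleGibbsBlockPlaquetteTransportFreeLinearisationLocal`.

HONEST FRAMING.  Deterministic lattice bookkeeping on the tree's own objects (`--supports stmt-QuantumFields-19936`); the locality radius is the
crude walk hull `(d+4)L + 2` of the tree's Stokes letters (print: the four blocks `Δ(p′)`); proves no stub, crux, rung or summit statement;
`stub_linTest`, «ShallowFluxSecondMomentL», (Q), K1, `MeanDeviationL`, `HistoryTailL` are NOT proved; the Yang–Mills mass gap is NOT proved.

References: [Balaban1985Averaging] T. Bałaban, CMP 98 (1985) 17–51, (19) p. 21, (47)–(48) and Prop. 1 (51) pp. 25–26 («it is a local result»),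
(124) p. 36; [Balaban1987RG1] T. Bałaban, CMP 109 (1987) 249–301, (0.3)–(0.4) pp. 252–253.
-/

noncomputable section

set_option autoImplicit false

open scoped BigOperators

namespace Summit.QuantumFields.YangMills.Theorems.BlockPlaquetteLinearisationLocal

open Literature.MathematicalPhysics.QuantumFieldTheory.Balaban1983to89
open Literature.MathematicalPhysics.QuantumFieldTheory.Balaban1983to89.B10Eq47AxialChi (shiftN rowProd rect)
open Literature.MathematicalPhysics.QuantumFieldTheory.Balaban1983to89.BlockAveraging (avgFun off off_bounds)
open Literature.MathematicalPhysics.QuantumFieldTheory.Balaban1983to89.ExpMeanLog (expMeanLogSU deltaSU)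
open Literature.MathematicalPhysics.QuantumFieldTheory.Balaban1983to89.LatticeWordStokes (length_stairWord_le)
open T4Continuum (holAt walk walkEnd stairWord Letter walkEnd_append)
open Summit.QuantumFields.YangMills.Theorems.BlockPlaquetteOneStepLinearisation (norm_plaqHol_avgFun_sub_one_sub_offsetMean_le_of_atoms)
open Summit.QuantumFields.YangMills.Theorems.N21LocalAveragedRegularity
  (dist1_loopHol_le_loc_src dist1_loopHol_le_loc_shift dist1_zWord_le_loc dist1_rect_LL_le_loc dist1_rect_stair_le_loc)
open Summit.QuantumFields.YangMills.Theorems.UnitScaleGibbsBlockPlaquetteOneStepFullLinearisation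
  (conj_sum_sum_conj_eq norm_coe_conj_sub_one_sub_conj_le norm_sub_smul_sum_le_of_forall sq_mul_le_one_of_smallness card_index_pos
    norm_sum_sum_conj_le)
open Summit.QuantumFields.YangMills.Theorems.UnitScaleGibbsBlockPlaquetteStokesLinearisation (norm_rect_sub_one_sub_sum_conj_plaq_le)
open Summit.QuantumFields.YangMills.Theorems.UnitScaleGibbsBlockPlaquetteStokesLetters (one_add_pow_sub_one_sub_mul_le_sq)
open Summit.QuantumFields.YangMills.BalabanUVNodes.N20LCSAvgDomination (shiftN_shiftN_eq_walkEnd)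

variable {P : Params} {j : ℕ}

/-! ## §0 The tile plaquettes of a translated square are walk sites of the hull -/

section Tile

variable {G : Type*} [GaugeGroup G]

/-- **THE TILE OF A TRANSLATED SQUARE LIES IN THE HULL**: for `x = walkEnd (emb y) Γ^σ(n)` (`n = off r`) and `t, s < L`, the plaquette cornered at
`x + t e_ν + s e_μ` is cornered at `walkEnd (emb y) v` with `|v| ≤ (d+4)L`; so a walk-local bound of radius `R ≥ (d+4)L` at `emb y` applies to it.
[cite: Balaban1987RG1, (0.3) p.252] -/
theorem walkLocal_tile {δ : ℝ} (F : Plaq P j → ℝ) (y : Site P (j + 1)) {R : ℕ} (hR : (P.d + 4) * P.L ≤ R)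
    (hF : ∀ v : List (Letter P.d), v.length ≤ R → ∀ (a b : Fin P.d) (h : a < b), F ⟨walkEnd (emb y) v, a, b, h⟩ ≤ δ)
    {μ ν : Fin P.d} (hμν : μ < ν) (σ : Equiv.Perm (Fin P.d)) (r : Fin P.d → Fin P.L) :
    ∀ t, t < P.L → ∀ s, s < P.L →
      F ⟨shiftN (shiftN (walkEnd (emb y) (stairWord σ (off r))) ν t) μ s, μ, ν, hμν⟩ ≤ δ := by
  intro t ht s hs
  have hn : ∀ κ, (off r κ).natAbs ≤ (P.L - 1) / 2 := fun κ => by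
    have h := off_bounds r κ
    omega
  have hlen := length_stairWord_le σ (off r) _ hn
  have hdL : P.d * ((P.L - 1) / 2) ≤ P.d * P.L := Nat.mul_le_mul_left _ (by omega)
  have e : (P.d + 4) * P.L = P.d * P.L + 4 * P.L := by ring
  rw [shiftN_shiftN_eq_walkEnd, ← walkEnd_append]
  refine hF _ ?_ μ ν hμν
  rw [List.length_append, List.length_append, List.length_replicate, List.length_replicate]
  omega

end Tile

section Main

open scoped Matrix.Norms.L2Operator

variable {n : Type*} [Fintype n] [DecidableEq n] [Nonempty n]

/-! ## §1 (M1) under the walk-local hypothesis -/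

/-- ★ **(M1) LOCAL: THE COARSE PLAQUETTE OF THE (0.4)+`exp[mean log]` AVERAGED FIELD TO FIRST ORDER, OFFSET-MEAN KEPT, UNDER THE WALK-LOCAL
HYPOTHESIS.**  If every fine plaquette cornered at `walkEnd (emb y) v`, `|v| ≤ (d+4)L + 2`, is within `a ≥ 0` of `1` and
`s = (((d+4)L)²/4)·a ≤ δ_N/2`, then for the coarse plaquette `p′ = ⟨y; μ < ν⟩`
  `‖(Ū(∂p′) − 1) − |J|⁻¹ Σ_{J=(r,σ,τ,ρ,ω)} (T_{r,σ}·U(∂(p′)_{x(r,σ)})·T_{r,σ}⁻¹ − 1)‖ ≤ 143·s²`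
— the SAME constant as the global ✓`norm_plaqHol_avgFun_sub_one_sub_offsetMean_le`, with NO hypothesis on any other plaquette of the torus
(the atomised (M1) fed with ✓`N21LocalAveragedRegularity` §1).  Print: «it is a local result; the bound above depends on bounds for V(∂p) − 1 on
Δ(p′)» (p. 25). [cite: Balaban1985Averaging, (47)-(48) and Prop. 1 (51) pp.25-26; Balaban1987RG1, (0.3)-(0.4) pp.252-253] -/
theorem norm_plaqHol_avgFun_sub_one_sub_offsetMean_le_loc {a : ℝ} (ha : 0 ≤ a) {U : GaugeField P j (Matrix.specialUnitaryGroup n ℂ)}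
    (hs : ((((P.d + 4) * P.L : ℕ) : ℝ) ^ 2 / 4) * a ≤ deltaSU n / 2) (y : Site P (j + 1)) {μ ν : Fin P.d} (hμν : μ < ν)
    (hU : ∀ v : List (Letter P.d), v.length ≤ (P.d + 4) * P.L + 2 →
      ∀ (a' b : Fin P.d) (h : a' < b), dist1 (GaugeField.plaqHol U ⟨walkEnd (emb y) v, a', b, h⟩) ≤ a) :
    ‖(((GaugeField.plaqHol (avgFun (expMeanLogSU (n := n)) U) ⟨y, μ, ν, hμν⟩ : Matrix.specialUnitaryGroup n ℂ) : Matrix n n ℂ) - 1) -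
        ((Fintype.card ((Fin P.d → Fin P.L) × Equiv.Perm (Fin P.d) × Equiv.Perm (Fin P.d) × Equiv.Perm (Fin P.d) ×
          Equiv.Perm (Fin P.d)) : ℂ))⁻¹ • ∑ J : (Fin P.d → Fin P.L) × Equiv.Perm (Fin P.d) × Equiv.Perm (Fin P.d) ×
          Equiv.Perm (Fin P.d) × Equiv.Perm (Fin P.d),
          ((((holAt U (walk (emb y) (stairWord J.2.1 (off J.1))) * rect U (walkEnd (emb y) (stairWord J.2.1 (off J.1))) μ ν P.L P.L *
            (holAt U (walk (emb y) (stairWord J.2.1 (off J.1))))⁻¹ : Matrix.specialUnitaryGroup n ℂ)) : Matrix n n ℂ) - 1)‖ ≤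
      143 * (((((P.d + 4) * P.L : ℕ) : ℝ) ^ 2 / 4) * a) ^ 2 := by
  have h2 : (P.d + 2) * P.L + 2 ≤ (P.d + 4) * P.L + 2 := by nlinarith
  have h3 : (P.d + 3) * P.L + 2 ≤ (P.d + 4) * P.L + 2 := by nlinarith
  have h4 : 2 * P.L ≤ (P.d + 4) * P.L + 2 := by nlinarith
  have h5 : (P.d + 4) * P.L ≤ (P.d + 4) * P.L + 2 := by omega
  exact norm_plaqHol_avgFun_sub_one_sub_offsetMean_le_of_atoms ha hs y hμν (dist1_loopHol_le_loc_src ha U y h2 hU μ)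
    (dist1_loopHol_le_loc_shift ha U y h3 hU μ ν) (dist1_loopHol_le_loc_shift ha U y h3 hU ν μ) (dist1_loopHol_le_loc_src ha U y h2 hU ν)
    (fun r σ ρ => dist1_zWord_le_loc ha U y le_rfl hU μ ν σ ρ r) (dist1_rect_LL_le_loc U y h4 hU hμν)
    (fun r σ => dist1_rect_stair_le_loc U y h5 hU hμν σ r)

/-! ## §2 (K) under the walk-local hypothesis -/

/-- ★★ **(K) LOCAL: ONE AVERAGING STEP LINEARISED DOWN TO THE FINE PLAQUETTE VARIABLES, UNDER THE WALK-LOCAL HYPOTHESIS.**  If every fine plaquette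
cornered at `walkEnd (emb y) v`, `|v| ≤ (d+4)L + 2`, is within `a ≥ 0` of `1` and `((d+4)L)²a∕4 ≤ δ_N∕2`, then at `p′ = ⟨y; μ < ν⟩`
`‖Ū(∂p′) − 1 − |J|⁻¹ Σ_J Σ_{t<L} Σ_{s<L} (T_J T^J_{s,t})·(U(∂p^J_{s,t}) − 1)·(T_J T^J_{s,t})*‖ ≤ 143·s² + (L²a)²` (px10's ✓(K) verbatim, re-fed: the local
(M1) of §1, and (b′) ✓`norm_rect_sub_one_sub_sum_conj_plaq_le` at every corner `x_J`, whose `L²` tile plaquettes are walk sites of the hull, §0).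
[cite: Balaban1985Averaging, (124) p.36 with (19) p.21; Balaban1987RG1, (0.3)-(0.4) pp.252-253] -/
theorem norm_plaqHol_avgFun_sub_one_sub_fullLin_le_loc {a : ℝ} (ha : 0 ≤ a) {U : GaugeField P j (Matrix.specialUnitaryGroup n ℂ)}
    (hs : ((((P.d + 4) * P.L : ℕ) : ℝ) ^ 2 / 4) * a ≤ deltaSU n / 2) (y : Site P (j + 1)) {μ ν : Fin P.d} (hμν : μ < ν)
    (hU : ∀ v : List (Letter P.d), v.length ≤ (P.d + 4) * P.L + 2 →
      ∀ (a' b : Fin P.d) (h : a' < b), dist1 (GaugeField.plaqHol U ⟨walkEnd (emb y) v, a', b, h⟩) ≤ a) :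
    ‖(((GaugeField.plaqHol (avgFun (expMeanLogSU (n := n)) U) ⟨y, μ, ν, hμν⟩ : Matrix.specialUnitaryGroup n ℂ) : Matrix n n ℂ) - 1) -
        ((Fintype.card ((Fin P.d → Fin P.L) × Equiv.Perm (Fin P.d) × Equiv.Perm (Fin P.d) × Equiv.Perm (Fin P.d) ×
          Equiv.Perm (Fin P.d)) : ℂ))⁻¹ • ∑ J : (Fin P.d → Fin P.L) × Equiv.Perm (Fin P.d) × Equiv.Perm (Fin P.d) ×
          Equiv.Perm (Fin P.d) × Equiv.Perm (Fin P.d),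
          ∑ t ∈ Finset.range P.L, ∑ s ∈ Finset.range P.L,
            ((holAt U (walk (emb y) (stairWord J.2.1 (off J.1))) *
                (rowProd U (walkEnd (emb y) (stairWord J.2.1 (off J.1))) ν t *
                  rowProd U (shiftN (walkEnd (emb y) (stairWord J.2.1 (off J.1))) ν t) μ s) : Matrix.specialUnitaryGroup n ℂ) : Matrix n n ℂ) *
              (((GaugeField.plaqHol U ⟨shiftN (shiftN (walkEnd (emb y) (stairWord J.2.1 (off J.1))) ν t) μ s, μ, ν, hμν⟩ :
                Matrix.specialUnitaryGroup n ℂ) : Matrix n n ℂ) - 1) *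
              star ((holAt U (walk (emb y) (stairWord J.2.1 (off J.1))) *
                (rowProd U (walkEnd (emb y) (stairWord J.2.1 (off J.1))) ν t *
                  rowProd U (shiftN (walkEnd (emb y) (stairWord J.2.1 (off J.1))) ν t) μ s) : Matrix.specialUnitaryGroup n ℂ) : Matrix n n ℂ)‖ ≤
      143 * (((((P.d + 4) * P.L : ℕ) : ℝ) ^ 2 / 4) * a) ^ 2 + (((P.L * P.L : ℕ) : ℝ) * a) ^ 2 := by
  -- adapted from px10's ✓`UnitScaleGibbsBlockPlaquetteOneStepFullLinearisation.norm_plaqHol_avgFun_sub_one_sub_fullLin_le` (global hypothesis)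
  have hLa : ((P.L * P.L : ℕ) : ℝ) * a ≤ 1 := sq_mul_le_one_of_smallness (n := n) ha hs
  have h5 : (P.d + 4) * P.L ≤ (P.d + 4) * P.L + 2 := by omega
  refine norm_sub_smul_sum_le_of_forall _ _ _ _ (norm_plaqHol_avgFun_sub_one_sub_offsetMean_le_loc ha hs y hμν hU) (fun J => ?_) ?_
  · -- (b′) at the corner `x_J`, conjugated by `T_J`; the tile plaquettes are walk sites of the hull
    have hb := norm_rect_sub_one_sub_sum_conj_plaq_le U (walkEnd (emb y) (stairWord J.2.1 (off J.1))) hμν P.L P.L ha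
      (walkLocal_tile (fun q => dist1 (GaugeField.plaqHol U q)) y h5 hU hμν J.2.1 J.1)
    have hb' := (norm_coe_conj_sub_one_sub_conj_le (holAt U (walk (emb y) (stairWord J.2.1 (off J.1)))) _ _).trans
      (hb.trans (one_add_pow_sub_one_sub_mul_le_sq ha (P.L * P.L) hLa))
    rw [conj_sum_sum_conj_eq] at hb'
    exact hb'
  · rw [norm_inv, Complex.norm_natCast]
    have hc : (0 : ℝ) < Fintype.card ((Fin P.d → Fin P.L) × Equiv.Perm (Fin P.d) × Equiv.Perm (Fin P.d) ×
        Equiv.Perm (Fin P.d) × Equiv.Perm (Fin P.d)) := by exact_mod_cast card_index_pos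
    field_simp

/-! ## §3 (S) under the walk-local hypothesis -/

/-- ★★ **(S) LOCAL: THE SUBSTITUTION STEP OF THE `j`-FOLD INDUCTION, UNDER THE WALK-LOCAL HYPOTHESES.**  Under §2's hypotheses, if the fine plaquette
deviations carry a first-order proxy `U(∂q) − 1 = A q + R q` (an identity: the consumer's definition of `R`) whose remainder is bounded,
`‖R q‖ ≤ ρ`, AT THE PLAQUETTES CORNERED IN THE HULL `walkEnd (emb y) v`, `|v| ≤ (d+4)L + 2` (nowhere else), then
`‖Ū(∂p′) − 1 − |J|⁻¹ Σ_J Σ_{t<L} Σ_{s<L} (T_J T^J_{s,t})·A(p^J_{s,t})·(T_J T^J_{s,t})*‖ ≤ 143·s² + (L²a)² + L²·ρ` (px10's ✓(S) verbatim, re-fed).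
[cite: Balaban1985Averaging, (124) p.36 with (19) p.21; Balaban1987RG1, (0.3)-(0.4) pp.252-253] -/
theorem norm_plaqHol_avgFun_sub_one_sub_fullLin_proxy_le_loc {a ρ : ℝ} (ha : 0 ≤ a) {U : GaugeField P j (Matrix.specialUnitaryGroup n ℂ)}
    (hs : ((((P.d + 4) * P.L : ℕ) : ℝ) ^ 2 / 4) * a ≤ deltaSU n / 2) (y : Site P (j + 1)) {μ ν : Fin P.d} (hμν : μ < ν)
    (hU : ∀ v : List (Letter P.d), v.length ≤ (P.d + 4) * P.L + 2 →
      ∀ (a' b : Fin P.d) (h : a' < b), dist1 (GaugeField.plaqHol U ⟨walkEnd (emb y) v, a', b, h⟩) ≤ a)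
    (A R : Plaq P j → Matrix n n ℂ)
    (hAR : ∀ q : Plaq P j, (((GaugeField.plaqHol U q : Matrix.specialUnitaryGroup n ℂ) : Matrix n n ℂ) - 1) = A q + R q)
    (hR : ∀ v : List (Letter P.d), v.length ≤ (P.d + 4) * P.L + 2 →
      ∀ (a' b : Fin P.d) (h : a' < b), ‖R ⟨walkEnd (emb y) v, a', b, h⟩‖ ≤ ρ) :
    ‖(((GaugeField.plaqHol (avgFun (expMeanLogSU (n := n)) U) ⟨y, μ, ν, hμν⟩ : Matrix.specialUnitaryGroup n ℂ) : Matrix n n ℂ) - 1) -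
        ((Fintype.card ((Fin P.d → Fin P.L) × Equiv.Perm (Fin P.d) × Equiv.Perm (Fin P.d) × Equiv.Perm (Fin P.d) ×
          Equiv.Perm (Fin P.d)) : ℂ))⁻¹ • ∑ J : (Fin P.d → Fin P.L) × Equiv.Perm (Fin P.d) × Equiv.Perm (Fin P.d) ×
          Equiv.Perm (Fin P.d) × Equiv.Perm (Fin P.d),
          ∑ t ∈ Finset.range P.L, ∑ s ∈ Finset.range P.L,
            ((holAt U (walk (emb y) (stairWord J.2.1 (off J.1))) *
                (rowProd U (walkEnd (emb y) (stairWord J.2.1 (off J.1))) ν t *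
                  rowProd U (shiftN (walkEnd (emb y) (stairWord J.2.1 (off J.1))) ν t) μ s) : Matrix.specialUnitaryGroup n ℂ) : Matrix n n ℂ) *
              A ⟨shiftN (shiftN (walkEnd (emb y) (stairWord J.2.1 (off J.1))) ν t) μ s, μ, ν, hμν⟩ *
              star ((holAt U (walk (emb y) (stairWord J.2.1 (off J.1))) *
                (rowProd U (walkEnd (emb y) (stairWord J.2.1 (off J.1))) ν t *
                  rowProd U (shiftN (walkEnd (emb y) (stairWord J.2.1 (off J.1))) ν t) μ s) : Matrix.specialUnitaryGroup n ℂ) : Matrix n n ℂ)‖ ≤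
      143 * (((((P.d + 4) * P.L : ℕ) : ℝ) ^ 2 / 4) * a) ^ 2 + (((P.L * P.L : ℕ) : ℝ) * a) ^ 2 + ((P.L * P.L : ℕ) : ℝ) * ρ := by
  -- adapted from px10's ✓`UnitScaleGibbsBlockPlaquetteOneStepFullLinearisation.norm_plaqHol_avgFun_sub_one_sub_fullLin_proxy_le`
  have h5 : (P.d + 4) * P.L ≤ (P.d + 4) * P.L + 2 := by omega
  refine norm_sub_smul_sum_le_of_forall _ _ _ _ (norm_plaqHol_avgFun_sub_one_sub_fullLin_le_loc ha hs y hμν hU) (fun J => ?_) ?_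
  · -- the difference of the two transported sums is the transported sum of the remainders `R` on the tile (walk sites of the hull)
    rw [← Finset.sum_sub_distrib]
    simp_rw [← Finset.sum_sub_distrib, ← sub_mul, ← mul_sub, hAR, add_sub_cancel_left]
    exact norm_sum_sum_conj_le _ _ (walkLocal_tile (fun q => ‖R q‖) y h5 hR hμν J.2.1 J.1)
  · rw [norm_inv, Complex.norm_natCast]
    have hc : (0 : ℝ) < Fintype.card ((Fin P.d → Fin P.L) × Equiv.Perm (Fin P.d) × Equiv.Perm (Fin P.d) ×
        Equiv.Perm (Fin P.d) × Equiv.Perm (Fin P.d)) := by exact_mod_cast card_index_pos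
    field_simp

end Main

end Summit.QuantumFields.YangMills.Theorems.BlockPlaquetteLinearisationLocal

end
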